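import Literature.NumberTheory.DiophantineGeometry.BrightKernelLattice
import Literature.NumberTheory.LFunctions.PrimeCountingThetaRatio
import Mathlib.Analysis.SpecialFunctions.Stirling
import Mathlib.Analysis.SpecialFunctions.Gamma.BohrMollerup
import Mathlib.Analysis.SpecialFunctions.Pow.Asymptotics
import HarnessLib

/-!
# Bright's lower bound in the abc conjecture: the asymptotic optimisation (§3.1)

Topic `Literature/NumberTheory/DiophantineGeometry`. Everything in this file is PROVED (no named
facts, no definitions).

C. Bright, *A new lower bound in the abc conjecture*, Canad. Math. Bull. 67 (2024), §3.1 and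
Theorem 3.1: from Lemma 3.1 (`exists_abcTriple_two_mul_log_le_rankinBound`, file
`BrightKernelLattice.lean`) applied to the first `n` odd primes with `2^{m-1} ≈ e^{Θ + 2(n+1)}`
(`Θ = ∑ log p_i`), the abc triples produced satisfy `log(c/rad) > 2(n+1)` and
`log c ≤ (e/(2δ) + o(1)) p_n²`, whence `c > rad(abc) exp(κ √(log c)/log log c)` for every
`κ < 4√(2δ/e)`, `δ = δ(x) = ((1-x)/(2-x))^{x-1} (e/x)^x Γ(1+x)` the constant of Rankin's bound at
the parameter `x = 1/q` (Corollary 2.4). The file provides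

* `sqrt_div_log_le_sqrt_div_log` : monotonicity of `s ↦ √s / log s` on `[e², ∞)` (elementary);
* `log_Gamma_add_one_le` : `log Γ(y+1) ≤ 1 + ½ log(y+1) + (y+1)(log(y+1) - 1)` for `y ≥ e`
  (from `Γ(y+1) ≤ ⌈y⌉!` and Mathlib's monotone Stirling sequence), the upper-bound half of
  Stirling's formula needed for `Γ(xN+1)^{1/N} ∼ (xN/e)^x` (Bright, proof of Cor. 2.4);
* `log_half_rankinBound_le`, `log_half_rankinBound_primes_le` : the logarithm of (half) the
  Rankin bound of Lemma 3.1 for the first `n` odd primes, `ρ = 1 - 1/(n+1)`,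
  `2^{m-1} = 2^{⌈(Θ+2(n+1))/log 2⌉}`, is at most `2 log p_n + log(e/(2δ)) + ε_n` with an explicit
  `ε_n`;
* `tendsto_brightError` : `ε_n → 0` (prime number theorem inputs from
  `PrimeCountingThetaRatio.lean`); `eventually_two_log_nth_prime_add_lt` : `2 log p_n + C < 3 log n`
  eventually (so the bound is `< n³`, as Lemma 3.1 requires);
* `exists_abcTriple_exp_lt` : the deterministic core at one level `n`;
* `bright_infinite_abcTriples` : for `0 < x < 1` and `κ ≥ 0` with `κ² e/32 < δ(x)` there are
  infinitely many abc triples with `rad(abc) exp(κ √(log c)/log log c) < c` (Theorem 3.1 of the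
  paper with `δ = δ(x)`; the numerical instance `x = 9/14`, `κ = 6.563` is
  `Literature.Barriers.ABC.bright2024_lowerBound`, discharged in
  `Literature/Barriers/ABC/EpsilonCannotBeDroppedProofs.lean`).

## References

* C. Bright, *A new lower bound in the abc conjecture*, Canad. Math. Bull. 67 (2024) 369–378,
  Corollary 2.4, Lemma 3.1, §3.1 and Theorem 3.1 [Bright2024].
-/

noncomputable section

open Filter Asymptotics Real Finset
open scoped Topology Nat

namespace Literature.NumberTheory.DiophantineGeometry

/-! ### Monotonicity of `√s / log s` -/

/-- For `e² ≤ s ≤ u` (i.e. `log s ≥ 2`), `√s / log s ≤ √u / log u`: with `v = √u/√s ≥ 1`,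
`2 log v ≤ 2(v-1) ≤ (v-1) log s`. [folklore] -/
theorem sqrt_div_log_le_sqrt_div_log {s u : ℝ} (hs : 0 < s) (hlog : 2 ≤ Real.log s)
    (hsu : s ≤ u) : Real.sqrt s / Real.log s ≤ Real.sqrt u / Real.log u := by
  have hu : 0 < u := lt_of_lt_of_le hs hsu
  have hlogu : 2 ≤ Real.log u := hlog.trans (Real.log_le_log hs hsu)
  have hss : 0 < Real.sqrt s := Real.sqrt_pos.mpr hs
  have hsu' : 0 < Real.sqrt u := Real.sqrt_pos.mpr hu
  set v := Real.sqrt u / Real.sqrt s with hv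
  have hv1 : 1 ≤ v := by
    rw [hv, le_div_iff₀ hss, one_mul]
    exact Real.sqrt_le_sqrt hsu
  have hv0 : 0 < v := by linarith
  have huv : Real.sqrt u = v * Real.sqrt s := by rw [hv]; field_simp
  have hlogu_eq : Real.log u = 2 * Real.log v + Real.log s := by
    have h1 : u = (v * Real.sqrt s) ^ 2 := by rw [← huv, Real.sq_sqrt hu.le]
    rw [h1, Real.log_pow, Real.log_mul hv0.ne' hss.ne', Real.log_sqrt hs.le]
    push_cast
    ring
  have hkey : 2 * Real.log v ≤ (v - 1) * Real.log s := by
    have h1 : Real.log v ≤ v - 1 := Real.log_le_sub_one_of_pos hv0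
    nlinarith
  rw [div_le_div_iff₀ (by linarith) (by linarith), huv, hlogu_eq]
  nlinarith [hss]

/-! ### An upper bound for `log Γ(y+1)` of Stirling type -/

/-- `M! ≤ e √M (M/e)^M` for `M ≥ 1` (the Stirling sequence `M!/(√(2M)(M/e)^M)` is decreasing
from its value `e/√2` at `M = 1`; Mathlib `Stirling.stirlingSeq'_antitone`). [folklore] -/
theorem factorial_le_exp_mul_sqrt_mul_pow {M : ℕ} (hM : 1 ≤ M) :
    ((M ! : ℕ) : ℝ) ≤ Real.exp 1 * Real.sqrt M * ((M : ℝ) / Real.exp 1) ^ M := by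
  obtain ⟨k, rfl⟩ : ∃ k, M = k + 1 := ⟨M - 1, by omega⟩
  have h := Stirling.stirlingSeq'_antitone (Nat.zero_le k)
  simp only [Function.comp_apply, Nat.succ_eq_add_one, zero_add, Stirling.stirlingSeq_one] at h
  rw [Stirling.stirlingSeq] at h
  have hk0 : (0 : ℝ) < (k + 1 : ℕ) := by positivity
  have hden : 0 < Real.sqrt (2 * ((k + 1 : ℕ) : ℝ)) * (((k + 1 : ℕ) : ℝ) / Real.exp 1) ^ (k + 1) := by
    positivity
  rw [div_le_iff₀ hden] at h
  have hsq : Real.sqrt (2 * ((k + 1 : ℕ) : ℝ)) = Real.sqrt 2 * Real.sqrt ((k + 1 : ℕ) : ℝ) :=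
    Real.sqrt_mul (by norm_num) _
  rw [hsq] at h
  have h2 : Real.sqrt 2 ≠ 0 := by positivity
  calc (((k + 1)! : ℕ) : ℝ) ≤ Real.exp 1 / Real.sqrt 2 * (Real.sqrt 2 * Real.sqrt ((k + 1 : ℕ) : ℝ)
        * (((k + 1 : ℕ) : ℝ) / Real.exp 1) ^ (k + 1)) := h
    _ = Real.exp 1 * Real.sqrt ((k + 1 : ℕ) : ℝ) * (((k + 1 : ℕ) : ℝ) / Real.exp 1) ^ (k + 1) := by
        field_simp

/-- **Upper Stirling bound for `log Γ`.** For `y ≥ e`: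
`log Γ(y+1) ≤ 1 + ½ log(y+1) + (y+1)(log(y+1) - 1)`. Proof: `Γ` is increasing on `[2, ∞)`, so
`Γ(y+1) ≤ Γ(⌈y⌉+1) = ⌈y⌉! ≤ e √⌈y⌉ (⌈y⌉/e)^{⌈y⌉} ≤ e √(y+1) ((y+1)/e)^{y+1}` (`⌈y⌉ ≤ y+1`,
`(y+1)/e ≥ 1`). [folklore] -/
theorem log_Gamma_add_one_le {y : ℝ} (hy : Real.exp 1 ≤ y) :
    Real.log (Real.Gamma (y + 1))
      ≤ 1 + (1 / 2) * Real.log (y + 1) + (y + 1) * (Real.log (y + 1) - 1) := by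
  have he : (1 : ℝ) < Real.exp 1 := by have := Real.add_one_lt_exp (one_ne_zero); linarith
  have hy1 : 1 < y := he.trans_le hy
  have hy0 : 0 < y := by linarith
  set M := ⌈y⌉₊ with hM
  have hM1 : 1 ≤ M := Nat.one_le_ceil_iff.mpr hy0 |> fun h => h
  have hyM : y ≤ M := Nat.le_ceil y
  have hMy : (M : ℝ) ≤ y + 1 := by
    have := Nat.ceil_lt_add_one hy0.le
    rw [← hM] at this
    linarith
  have hM0 : (0 : ℝ) < M := by exact_mod_cast hM1
  -- `Γ(y+1) ≤ Γ(M+1) = M!`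
  have hmono : Real.Gamma (y + 1) ≤ Real.Gamma ((M : ℝ) + 1) := by
    rcases eq_or_lt_of_le (show y + 1 ≤ (M : ℝ) + 1 by linarith) with h | h
    · rw [h]
    · exact (Real.Gamma_strictMonoOn_Ici (by simp; linarith) (by simp; linarith) h).le
  rw [Real.Gamma_nat_eq_factorial] at hmono
  have hfact := factorial_le_exp_mul_sqrt_mul_pow hM1
  -- `e √M (M/e)^M ≤ e √(y+1) ((y+1)/e)^(y+1)`
  set Y := y + 1 with hY
  have hYe : 1 ≤ Y / Real.exp 1 := by rw [le_div_iff₀ (Real.exp_pos 1)]; linarith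
  have hpow : ((M : ℝ) / Real.exp 1) ^ M ≤ (Y / Real.exp 1) ^ Y := by
    calc ((M : ℝ) / Real.exp 1) ^ M ≤ (Y / Real.exp 1) ^ M := by
          gcongr
      _ = (Y / Real.exp 1) ^ ((M : ℕ) : ℝ) := (Real.rpow_natCast _ _).symm
      _ ≤ (Y / Real.exp 1) ^ Y := Real.rpow_le_rpow_of_exponent_le hYe hMy
  have hsqrt : Real.sqrt M ≤ Real.sqrt Y := Real.sqrt_le_sqrt hMy
  have hΓ : Real.Gamma (y + 1) ≤ Real.exp 1 * Real.sqrt Y * (Y / Real.exp 1) ^ Y := by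
    calc Real.Gamma (y + 1) ≤ ((M ! : ℕ) : ℝ) := hmono
      _ ≤ Real.exp 1 * Real.sqrt M * ((M : ℝ) / Real.exp 1) ^ M := hfact
      _ ≤ Real.exp 1 * Real.sqrt Y * (Y / Real.exp 1) ^ Y := by gcongr
  have hY0 : 0 < Y := by rw [hY]; linarith
  have hΓ0 : 0 < Real.Gamma (y + 1) := Real.Gamma_pos_of_pos (by linarith)
  calc Real.log (Real.Gamma (y + 1)) ≤ Real.log (Real.exp 1 * Real.sqrt Y * (Y / Real.exp 1) ^ Y) :=
        Real.log_le_log hΓ0 hΓ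
    _ = 1 + (1 / 2) * Real.log Y + Y * (Real.log Y - 1) := by
        rw [Real.log_mul (by positivity) (by positivity), Real.log_mul (by positivity) (by positivity),
          Real.log_exp, Real.log_sqrt hY0.le, Real.log_rpow (by positivity),
          Real.log_div hY0.ne' (Real.exp_pos 1).ne', Real.log_exp]
        ring


/-! ### The logarithm of Rankin's bound (Bright 2024, §3.1) -/

/-- **The logarithm of (half) the Rankin bound of Lemma 3.1**, abstract form. For `0 < x < 1`,
`q = 1/x`, `n ≥ 1`, `N = n + 1` with `xN ≥ e`, `ρ = 1 - 1/N`, covolume data `Θ ≥ 0`, `G > 0` with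
`log G ≤ n L` (`L ≥ 0`) and `2^{m-1} = 2^{⌈(Θ + 2N)/log 2⌉}`:
`log(B/2) ≤ log N + Θ/N + L + 2 - log(2δ(x)) + ε`, where `B` is the bound of
`exists_abcTriple_two_mul_log_le_rankinBound`, `δ(x) = ((1-x)/(2-x))^{x-1}(e/x)^x Γ(x+1)` and
`ε = -log ρ + (log q + log 2 + 3 log n + log N + (3/2) log(xN+1))/N + x log(1 + 1/(xN))`
(Bright 2024, §3.1: `(1−ρ^q)^{-1} ≤ N`, `log 2^{m-1} ≤ Θ + 2N + log 2`, `G^{1/N} ≤ e^L`, and the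
Stirling bound `log_Gamma_add_one_le` for `Γ(xN+1)`). [cite: Bright2024, §3.1] -/
theorem log_half_rankinBound_le {x q : ℝ} (hx0 : 0 < x) (hx1 : x < 1) (hqx : x * q = 1) {n : ℕ}
    (hn : 1 ≤ n) (hxN : Real.exp 1 ≤ x * ((n + 1 : ℕ) : ℝ)) {Θ G L : ℝ} (hΘ : 0 ≤ Θ)
    (hG : 0 < G) (hL : 0 ≤ L) (hGL : Real.log G ≤ n * L) :
    Real.log ((1 / ((1 - 1 / ((n + 1 : ℕ) : ℝ)) * (((2 * q - 1) / (q - 1)) ^ (q - 1)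
        * ((n + 1 : ℕ) : ℝ) ^ (1 - q)) ^ (1 / q))) *
      (q * ((2 : ℝ) ^ (⌈(Θ + 2 * ((n + 1 : ℕ) : ℝ)) / Real.log 2⌉₊) * ((n : ℝ) ^ 3 * G))
        / ((1 - (1 - 1 / ((n + 1 : ℕ) : ℝ)) ^ q) *
          ((2 * Real.Gamma (1 / q + 1)) ^ (n + 1) / Real.Gamma ((n + 1 : ℕ) / q + 1))))
        ^ (1 / ((n + 1 : ℕ) : ℝ)))
    ≤ Real.log ((n + 1 : ℕ) : ℝ) + Θ / ((n + 1 : ℕ) : ℝ) + L + 2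
      - Real.log (2 * (((1 - x) / (2 - x)) ^ (x - 1) * (Real.exp 1 / x) ^ x * Real.Gamma (x + 1)))
      + (-Real.log (1 - 1 / ((n + 1 : ℕ) : ℝ))
        + (Real.log q + Real.log 2 + 3 * Real.log n + Real.log ((n + 1 : ℕ) : ℝ)
            + 3 / 2 * Real.log (x * ((n + 1 : ℕ) : ℝ) + 1)) / ((n + 1 : ℕ) : ℝ)
        + x * Real.log (1 + 1 / (x * ((n + 1 : ℕ) : ℝ)))) := by
  -- notation and positivity
  set N : ℝ := ((n + 1 : ℕ) : ℝ) with hN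
  have hNn : N = (n : ℝ) + 1 := by rw [hN]; push_cast; ring
  clear_value N
  have hn1 : (1 : ℝ) ≤ n := by exact_mod_cast hn
  have hN2 : (2 : ℝ) ≤ N := by rw [hNn]; linarith
  have hN0 : (0 : ℝ) < N := by linarith
  have hq : q = 1 / x := by field_simp; linarith [hqx]
  have hq1 : 1 < q := by rw [hq, lt_div_iff₀ hx0]; linarith
  have hq0 : 0 < q := by linarith
  have hqm1 : 0 < q - 1 := by linarith
  have h2qm1 : 0 < 2 * q - 1 := by linarith
  have hxq' : 1 / q = x := by rw [hq, one_div_one_div]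
  set ρ : ℝ := 1 - 1 / N with hρ
  clear_value ρ
  have hρ0 : 0 < ρ := by
    rw [hρ, sub_pos, div_lt_one hN0]; linarith
  have hρ1 : ρ < 1 := by rw [hρ]; have := one_div_pos.mpr hN0; linarith
  set c : ℝ := ((2 * q - 1) / (q - 1)) ^ (q - 1) with hc
  clear_value c
  have hc0 : 0 < c := by rw [hc]; exact Real.rpow_pos_of_pos (div_pos h2qm1 hqm1) _
  set D : ℝ := (2 : ℝ) ^ (⌈(Θ + 2 * N) / Real.log 2⌉₊) with hD
  clear_value D
  have hD0 : 0 < D := by rw [hD]; positivity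
  set V₁ : ℝ := (2 * Real.Gamma (1 / q + 1)) ^ (n + 1) / Real.Gamma (N / q + 1) with hV₁
  clear_value V₁
  have hΓx : 0 < Real.Gamma (x + 1) := Real.Gamma_pos_of_pos (by linarith)
  have hΓN : 0 < Real.Gamma (x * N + 1) := Real.Gamma_pos_of_pos (by positivity)
  have hV₁' : V₁ = (2 * Real.Gamma (x + 1)) ^ (n + 1) / Real.Gamma (x * N + 1) := by
    rw [hV₁, hxq']
    congr 2
    rw [hq]; field_simp
  have hV₁0 : 0 < V₁ := by rw [hV₁']; positivity
  have hρq : ρ ^ q < 1 := Real.rpow_lt_one hρ0.le hρ1 hq0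
  have h1ρq : 1 / N ≤ 1 - ρ ^ q := by
    have : ρ ^ q ≤ ρ := by
      calc ρ ^ q ≤ ρ ^ (1 : ℝ) := Real.rpow_le_rpow_of_exponent_ge hρ0 hρ1.le hq1.le
        _ = ρ := Real.rpow_one ρ
    rw [hρ] at this ⊢; linarith
  have h1ρq0 : 0 < 1 - ρ ^ q := lt_of_lt_of_le (one_div_pos.mpr hN0) h1ρq
  have hn0 : (0 : ℝ) < n := by linarith
  set Base : ℝ := q * (D * ((n : ℝ) ^ 3 * G)) / ((1 - ρ ^ q) * V₁) with hBase
  clear_value Base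
  have hBase0 : 0 < Base := by rw [hBase]; positivity
  have hcN : 0 < c * N ^ (1 - q) := mul_pos hc0 (Real.rpow_pos_of_pos hN0 _)
  set Rρ : ℝ := ρ * (c * N ^ (1 - q)) ^ (1 / q) with hRρ
  clear_value Rρ
  have hRρ0 : 0 < Rρ := by rw [hRρ]; exact mul_pos hρ0 (Real.rpow_pos_of_pos hcN _)
  -- Step 1: the exact logarithm
  have hlogHalf : Real.log (1 / Rρ * Base ^ (1 / N))
      = -Real.log ρ - x * Real.log c + (1 - x) * Real.log N
        + 1 / N * (Real.log q + Real.log D + 3 * Real.log n + Real.log G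
          + (-Real.log (1 - ρ ^ q)) + Real.log (Real.Gamma (x * N + 1)))
        - (Real.log 2 + Real.log (Real.Gamma (x + 1))) := by
    have e1 : Real.log (1 / Rρ * Base ^ (1 / N)) = -Real.log Rρ + 1 / N * Real.log Base := by
      rw [Real.log_mul (by positivity) (by positivity), Real.log_div one_ne_zero hRρ0.ne',
        Real.log_one, Real.log_rpow hBase0]
      ring
    have e2 : Real.log Rρ = Real.log ρ + x * Real.log c + (x - 1) * Real.log N := by
      rw [hRρ, Real.log_mul hρ0.ne' (Real.rpow_pos_of_pos hcN _).ne', Real.log_rpow hcN,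
        Real.log_mul hc0.ne' (Real.rpow_pos_of_pos hN0 _).ne', Real.log_rpow hN0, hxq']
      have : x * (1 - q) = x - 1 := by rw [mul_sub, hqx, mul_one]
      rw [mul_add, ← mul_assoc, this]
      ring
    have e3 : Real.log Base = Real.log q + Real.log D + 3 * Real.log n + Real.log G
        - Real.log (1 - ρ ^ q) - Real.log V₁ := by
      rw [hBase, Real.log_div (by positivity) (by positivity), Real.log_mul hq0.ne' (by positivity),
        Real.log_mul hD0.ne' (by positivity), Real.log_mul (by positivity) hG.ne', Real.log_pow,
        Real.log_mul h1ρq0.ne' hV₁0.ne']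
      push_cast
      ring
    have e4 : Real.log V₁ = N * (Real.log 2 + Real.log (Real.Gamma (x + 1)))
        - Real.log (Real.Gamma (x * N + 1)) := by
      rw [hV₁', Real.log_div (by positivity) hΓN.ne', Real.log_pow,
        Real.log_mul two_ne_zero hΓx.ne', hNn]
      push_cast
      ring
    rw [e1, e2, e3, e4]
    field_simp
    ring
  -- Step 2: the four bounds
  have b1 : -Real.log (1 - ρ ^ q) ≤ Real.log N := by
    have := Real.log_le_log (one_div_pos.mpr hN0) h1ρq
    rw [Real.log_div one_ne_zero hN0.ne', Real.log_one] at this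
    linarith
  have b2 : Real.log D ≤ Θ + 2 * N + Real.log 2 := by
    have hl2 : 0 < Real.log 2 := Real.log_pos one_lt_two
    have hnn : 0 ≤ (Θ + 2 * N) / Real.log 2 := by positivity
    have hceil : (⌈(Θ + 2 * N) / Real.log 2⌉₊ : ℝ) < (Θ + 2 * N) / Real.log 2 + 1 :=
      Nat.ceil_lt_add_one hnn
    rw [hD, Real.log_pow]
    calc (⌈(Θ + 2 * N) / Real.log 2⌉₊ : ℝ) * Real.log 2
        ≤ ((Θ + 2 * N) / Real.log 2 + 1) * Real.log 2 :=
          mul_le_mul_of_nonneg_right hceil.le hl2.le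
      _ = Θ + 2 * N + Real.log 2 := by field_simp
  have b3 : Real.log G ≤ n * L := hGL
  have b4 : Real.log (Real.Gamma (x * N + 1))
      ≤ 1 + 1 / 2 * Real.log (x * N + 1) + (x * N + 1) * (Real.log (x * N + 1) - 1) :=
    log_Gamma_add_one_le hxN
  have hstep : Real.log (1 / Rρ * Base ^ (1 / N))
      ≤ -Real.log ρ - x * Real.log c + (1 - x) * Real.log N
        + 1 / N * (Real.log q + (Θ + 2 * N + Real.log 2) + 3 * Real.log n + n * L
          + Real.log N
          + (1 + 1 / 2 * Real.log (x * N + 1) + (x * N + 1) * (Real.log (x * N + 1) - 1)))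
        - (Real.log 2 + Real.log (Real.Gamma (x + 1))) := by
    rw [hlogHalf]
    gcongr
  -- Step 3: the constant `log(2δ)` and the expansion of `log (xN+1)`
  have hrat : 0 < (1 - x) / (2 - x) := div_pos (by linarith) (by linarith)
  have hxc : x * Real.log c = (x - 1) * Real.log ((1 - x) / (2 - x)) := by
    have h1 : (2 * q - 1) / (q - 1) = ((1 - x) / (2 - x))⁻¹ := by
      rw [hq, inv_div]
      have hx0' : x ≠ 0 := hx0.ne'
      have h2x : (2 : ℝ) - x ≠ 0 := by linarith
      have h1x : (1 : ℝ) - x ≠ 0 := by linarith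
      field_simp
    have h2 : q - 1 = (1 - x) / x := by rw [hq]; field_simp
    rw [hc, Real.log_rpow (div_pos h2qm1 hqm1), h1, Real.log_inv, h2]
    field_simp
    ring
  have hlog2δ : Real.log (2 * (((1 - x) / (2 - x)) ^ (x - 1) * (Real.exp 1 / x) ^ x
      * Real.Gamma (x + 1)))
      = Real.log 2 + ((x - 1) * Real.log ((1 - x) / (2 - x)) + x * (1 - Real.log x)
        + Real.log (Real.Gamma (x + 1))) := by
    rw [Real.log_mul two_ne_zero (by positivity), Real.log_mul (by positivity) hΓx.ne',
      Real.log_mul (by positivity) (by positivity), Real.log_rpow hrat,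
      Real.log_rpow (by positivity), Real.log_div (Real.exp_pos 1).ne' hx0.ne', Real.log_exp]
  have hlogY : Real.log (x * N + 1) = Real.log x + Real.log N + Real.log (1 + 1 / (x * N)) := by
    have : x * N + 1 = x * N * (1 + 1 / (x * N)) := by field_simp
    rw [this, Real.log_mul (by positivity) (by positivity), Real.log_mul hx0.ne' hN0.ne']
  -- Step 4: algebra
  have key : -Real.log ρ - x * Real.log c + (1 - x) * Real.log N
        + 1 / N * (Real.log q + (Θ + 2 * N + Real.log 2) + 3 * Real.log n + n * L
          + Real.log N
          + (1 + 1 / 2 * Real.log (x * N + 1) + (x * N + 1) * (Real.log (x * N + 1) - 1)))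
        - (Real.log 2 + Real.log (Real.Gamma (x + 1)))
      = Real.log N + Θ / N + L + 2
        - Real.log (2 * (((1 - x) / (2 - x)) ^ (x - 1) * (Real.exp 1 / x) ^ x
          * Real.Gamma (x + 1)))
        + (-Real.log ρ
          + (Real.log q + Real.log 2 + 3 * Real.log n + Real.log N
              + 3 / 2 * Real.log (x * N + 1)) / N
          + x * Real.log (1 + 1 / (x * N))) - L / N := by
    rw [hlog2δ, hxc, hlogY]
    have hL : (n : ℝ) * L = N * L - L := by rw [hNn]; ring
    rw [hL]
    set Lrat := Real.log ((1 - x) / (2 - x)) with hLrat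
    clear_value Lrat
    set Llog := Real.log (1 + 1 / (x * N)) with hLlog
    clear_value Llog
    field_simp
    ring
  have hLN : 0 ≤ L / N := div_nonneg hL hN0.le
  linarith [hstep, key, hLN]


/-! ### Specialisation to the first `n` odd primes -/

/-- The odd primes `p_1 < … < p_n` (`p_k` the `k`-th prime, `p_0 = 2`) are primes. [folklore] -/
theorem prime_nth_prime_succ (n : ℕ) (i : Fin n) : (Nat.nth Nat.Prime (i + 1)).Prime :=
  Nat.prime_nth_prime _

/-- The odd primes `p_1, …, p_n` are at least `3`. [folklore] -/
theorem three_le_nth_prime_succ (k : ℕ) : 3 ≤ Nat.nth Nat.Prime (k + 1) := by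
  have h := Nat.add_two_le_nth_prime (k + 1)
  omega

/-- The odd primes `p_1, …, p_n` are not `2`. [folklore] -/
theorem nth_prime_succ_ne_two (n : ℕ) (i : Fin n) : Nat.nth Nat.Prime (i + 1) ≠ 2 := by
  have := three_le_nth_prime_succ (i : ℕ)
  omega

/-- `i ↦ p_{i+1}` is injective on `Fin n`. [folklore] -/
theorem nth_prime_succ_injective (n : ℕ) :
    Function.Injective (fun i : Fin n => Nat.nth Nat.Prime (i + 1)) := by
  intro i j h
  have := (Nat.nth_strictMono Nat.infinite_setOf_prime).injective h
  exact Fin.ext (by omega)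

/-- `p_{i+1} ≤ p_n` for `i < n`. [folklore] -/
theorem nth_prime_succ_le (n : ℕ) (i : Fin n) : Nat.nth Nat.Prime (i + 1) ≤ Nat.nth Nat.Prime n :=
  (Nat.nth_monotone Nat.infinite_setOf_prime) (by omega)

/-- **The logarithm of (half) the Rankin bound for the first `n` odd primes** (Bright 2024,
§3.1): with `Θ = ∑_{i<n} log p_{i+1}`, `G = ∏_{i<n} log p_{i+1}`, `N = n+1`, `P = p_n`, `ρ = 1 - 1/N`
and `2^{m-1} = 2^{⌈(Θ+2N)/log 2⌉}`, the bound `B` of `exists_abcTriple_two_mul_log_le_rankinBound`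
satisfies `log(B/2) ≤ 2 log P + log(e/(2δ(x))) + ε_n`, where
`ε_n = [-log ρ + (log q + log 2 + 3 log n + log N + (3/2) log(xN+1))/N + x log(1 + 1/(xN))]
 + log(N log P / P) + (Θ/N - log P + 1)` (the last two terms are `o(1)` by the prime number
theorem, cf. `tendsto_brightError`). [cite: Bright2024, §3.1] -/
theorem log_half_rankinBound_primes_le {x q : ℝ} (hx0 : 0 < x) (hx1 : x < 1) (hqx : x * q = 1)
    {n : ℕ} (hn : 1 ≤ n) (hxN : Real.exp 1 ≤ x * ((n + 1 : ℕ) : ℝ)) :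
    Real.log ((1 / ((1 - 1 / ((n + 1 : ℕ) : ℝ)) * (((2 * q - 1) / (q - 1)) ^ (q - 1)
        * ((n + 1 : ℕ) : ℝ) ^ (1 - q)) ^ (1 / q))) *
      (q * ((2 : ℝ) ^ (⌈((∑ i : Fin n, Real.log (Nat.nth Nat.Prime (i + 1)))
          + 2 * ((n + 1 : ℕ) : ℝ)) / Real.log 2⌉₊)
          * ((n : ℝ) ^ 3 * ∏ i : Fin n, Real.log (Nat.nth Nat.Prime (i + 1))))
        / ((1 - (1 - 1 / ((n + 1 : ℕ) : ℝ)) ^ q) *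
          ((2 * Real.Gamma (1 / q + 1)) ^ (n + 1) / Real.Gamma ((n + 1 : ℕ) / q + 1))))
        ^ (1 / ((n + 1 : ℕ) : ℝ)))
    ≤ 2 * Real.log (Nat.nth Nat.Prime n)
      + Real.log (Real.exp 1 / (2 * (((1 - x) / (2 - x)) ^ (x - 1) * (Real.exp 1 / x) ^ x
          * Real.Gamma (x + 1))))
      + ((-Real.log (1 - 1 / ((n + 1 : ℕ) : ℝ))
          + (Real.log q + Real.log 2 + 3 * Real.log n + Real.log ((n + 1 : ℕ) : ℝ)
              + 3 / 2 * Real.log (x * ((n + 1 : ℕ) : ℝ) + 1)) / ((n + 1 : ℕ) : ℝ)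
          + x * Real.log (1 + 1 / (x * ((n + 1 : ℕ) : ℝ))))
        + Real.log (((n + 1 : ℕ) : ℝ) * Real.log (Nat.nth Nat.Prime n) / (Nat.nth Nat.Prime n))
        + ((∑ i : Fin n, Real.log (Nat.nth Nat.Prime (i + 1))) / ((n + 1 : ℕ) : ℝ)
            - Real.log (Nat.nth Nat.Prime n) + 1)) := by
  set P : ℕ := Nat.nth Nat.Prime n with hP
  set Θ : ℝ := ∑ i : Fin n, Real.log (Nat.nth Nat.Prime (i + 1)) with hΘ
  set G : ℝ := ∏ i : Fin n, Real.log (Nat.nth Nat.Prime (i + 1)) with hG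
  set N : ℝ := ((n + 1 : ℕ) : ℝ) with hN
  have hN0 : 0 < N := by rw [hN]; positivity
  have hP3 : (3 : ℝ) ≤ P := by
    rw [hP]
    obtain ⟨k, rfl⟩ : ∃ k, n = k + 1 := ⟨n - 1, by omega⟩
    exact_mod_cast three_le_nth_prime_succ k
  have hP0 : (0 : ℝ) < P := by linarith
  have hlogP : 1 < Real.log P := by
    rw [← Real.log_exp 1]
    refine Real.log_lt_log (Real.exp_pos 1) (lt_of_lt_of_le ?_ hP3)
    have := Real.exp_one_lt_d9; norm_num at this; linarith
  have hlogP0 : 0 < Real.log P := by linarith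
  have hLL : 0 ≤ Real.log (Real.log P) := Real.log_nonneg hlogP.le
  -- the hypotheses of the abstract lemma
  have hlogp : ∀ i : Fin n, 1 < Real.log (Nat.nth Nat.Prime (i + 1)) := by
    intro i
    rw [← Real.log_exp 1]
    have h3 : (3 : ℝ) ≤ Nat.nth Nat.Prime (i + 1) := by
      exact_mod_cast three_le_nth_prime_succ (i : ℕ)
    refine Real.log_lt_log (Real.exp_pos 1) (lt_of_lt_of_le ?_ h3)
    have := Real.exp_one_lt_d9; norm_num at this; linarith
  have hΘ0 : 0 ≤ Θ := Finset.sum_nonneg fun i _ => by linarith [hlogp i]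
  have hG0 : 0 < G := Finset.prod_pos fun i _ => by linarith [hlogp i]
  have hGL : Real.log G ≤ n * Real.log (Real.log P) := by
    rw [hG, Real.log_prod]
    · calc ∑ i : Fin n, Real.log (Real.log (Nat.nth Nat.Prime (i + 1)))
          ≤ ∑ _i : Fin n, Real.log (Real.log P) := by
            refine Finset.sum_le_sum fun i _ => Real.log_le_log (by linarith [hlogp i]) ?_
            have h3 : (0 : ℝ) < Nat.nth Nat.Prime (i + 1) := by
              have := three_le_nth_prime_succ (i : ℕ)
              exact_mod_cast (show 0 < Nat.nth Nat.Prime (i + 1) by omega)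
            refine Real.log_le_log h3 ?_
            rw [hP]; exact_mod_cast nth_prime_succ_le n i
        _ = n * Real.log (Real.log P) := by simp
    · intro i _; linarith [hlogp i]
  have hmain := log_half_rankinBound_le hx0 hx1 hqx hn hxN hΘ0 hG0 hLL hGL
  -- `log N + Θ/N + log log P = 2 log P - 1 + log(N log P/P) + (Θ/N - log P + 1)`
  have hsplit : Real.log N + Θ / N + Real.log (Real.log P)
      = 2 * Real.log P - 1 + Real.log (N * Real.log P / P) + (Θ / N - Real.log P + 1) := by
    rw [Real.log_div (by positivity) hP0.ne', Real.log_mul hN0.ne' hlogP0.ne']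
    ring
  have hδpos : 0 < 2 * (((1 - x) / (2 - x)) ^ (x - 1) * (Real.exp 1 / x) ^ x
      * Real.Gamma (x + 1)) := by
    have hrat : 0 < (1 - x) / (2 - x) := div_pos (by linarith) (by linarith)
    have := Real.Gamma_pos_of_pos (show 0 < x + 1 by linarith)
    positivity
  have hlogeδ : Real.log (Real.exp 1 / (2 * (((1 - x) / (2 - x)) ^ (x - 1)
      * (Real.exp 1 / x) ^ x * Real.Gamma (x + 1))))
      = 1 - Real.log (2 * (((1 - x) / (2 - x)) ^ (x - 1) * (Real.exp 1 / x) ^ x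
          * Real.Gamma (x + 1))) := by
    rw [Real.log_div (Real.exp_pos 1).ne' hδpos.ne', Real.log_exp]
  rw [hlogeδ]
  linarith [hmain, hsplit]


/-! ### The error term tends to zero -/

/-- `log(a n + b)/(n+1) → 0` for `a > 0`. [folklore] -/
theorem tendsto_log_linear_div_succ {a : ℝ} (b : ℝ) (ha : 0 < a) :
    Tendsto (fun n : ℕ => Real.log (a * n + b) / ((n + 1 : ℕ) : ℝ)) atTop (𝓝 0) := by
  have h1 : Tendsto (fun y : ℝ => Real.log y ^ 1 / (1 / a * y + (1 - b / a))) atTop (𝓝 0) :=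
    Real.tendsto_pow_log_div_mul_add_atTop (1 / a) (1 - b / a) 1 (by positivity)
  have h2 : Tendsto (fun n : ℕ => a * (n : ℝ) + b) atTop atTop :=
    tendsto_atTop_add_const_right _ b (tendsto_natCast_atTop_atTop.const_mul_atTop ha)
  refine (h1.comp h2).congr (fun n => ?_)
  simp only [Function.comp_apply, pow_one]
  congr 1
  push_cast
  field_simp
  ring

/-- `1/(n+1) → 0` with the cast `((n+1 : ℕ) : ℝ)`. [folklore] -/
theorem tendsto_one_div_succ_cast :
    Tendsto (fun n : ℕ => 1 / ((n + 1 : ℕ) : ℝ)) atTop (𝓝 0) := by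
  refine tendsto_one_div_add_atTop_nhds_zero_nat.congr (fun n => ?_)
  push_cast
  ring

/-- The elementary part of Bright's error term tends to `0`:
`-log(1 - 1/N) + (log q + log 2 + 3 log n + log N + (3/2) log(xN+1))/N + x log(1 + 1/(xN)) → 0`
(`N = n + 1`). [folklore] -/
theorem tendsto_brightError_elem {x : ℝ} (q : ℝ) (hx0 : 0 < x) :
    Tendsto (fun n : ℕ => -Real.log (1 - 1 / ((n + 1 : ℕ) : ℝ))
          + (Real.log q + Real.log 2 + 3 * Real.log n + Real.log ((n + 1 : ℕ) : ℝ)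
              + 3 / 2 * Real.log (x * ((n + 1 : ℕ) : ℝ) + 1)) / ((n + 1 : ℕ) : ℝ)
          + x * Real.log (1 + 1 / (x * ((n + 1 : ℕ) : ℝ)))) atTop (𝓝 0) := by
  have hinv := tendsto_one_div_succ_cast
  -- `-log(1 - 1/N) → 0`
  have hA : Tendsto (fun n : ℕ => -Real.log (1 - 1 / ((n + 1 : ℕ) : ℝ))) atTop (𝓝 0) := by
    have := ((tendsto_const_nhds (x := (1 : ℝ))).sub hinv).log (by norm_num)
    have := this.neg
    simpa using this
  -- the middle term
  have hB : Tendsto (fun n : ℕ => (Real.log q + Real.log 2 + 3 * Real.log n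
      + Real.log ((n + 1 : ℕ) : ℝ) + 3 / 2 * Real.log (x * ((n + 1 : ℕ) : ℝ) + 1))
      / ((n + 1 : ℕ) : ℝ)) atTop (𝓝 0) := by
    have t1 : Tendsto (fun n : ℕ => (Real.log q + Real.log 2) * (1 / ((n + 1 : ℕ) : ℝ)))
        atTop (𝓝 0) := by
      simpa using hinv.const_mul (Real.log q + Real.log 2)
    have t2 : Tendsto (fun n : ℕ => Real.log n / ((n + 1 : ℕ) : ℝ)) atTop (𝓝 0) := by
      refine (tendsto_log_linear_div_succ 0 one_pos).congr (fun n => ?_)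
      simp
    have t3 : Tendsto (fun n : ℕ => Real.log ((n + 1 : ℕ) : ℝ) / ((n + 1 : ℕ) : ℝ)) atTop (𝓝 0) := by
      refine (tendsto_log_linear_div_succ 1 one_pos).congr (fun n => ?_)
      push_cast
      ring_nf
    have t4 : Tendsto (fun n : ℕ => Real.log (x * ((n + 1 : ℕ) : ℝ) + 1) / ((n + 1 : ℕ) : ℝ))
        atTop (𝓝 0) := by
      refine (tendsto_log_linear_div_succ (x + 1) hx0).congr (fun n => ?_)
      push_cast
      ring_nf
    have := t1.add ((t2.const_mul 3).add (t3.add (t4.const_mul (3 / 2))))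
    simp only [mul_zero, add_zero] at this
    refine this.congr (fun n => ?_)
    field_simp
    ring
  -- `x log(1 + 1/(xN)) → 0`
  have hC : Tendsto (fun n : ℕ => x * Real.log (1 + 1 / (x * ((n + 1 : ℕ) : ℝ)))) atTop (𝓝 0) := by
    have h1 : Tendsto (fun n : ℕ => 1 / (x * ((n + 1 : ℕ) : ℝ))) atTop (𝓝 0) := by
      have := hinv.const_mul (1 / x)
      rw [mul_zero] at this
      refine this.congr (fun n => ?_)
      field_simp
    have h2 := ((tendsto_const_nhds (x := (1 : ℝ))).add h1).log (by norm_num)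
    have h3 := h2.const_mul x
    simpa using h3
  have := (hA.add hB).add hC
  simpa using this

/-- **Bright's error term tends to `0`**: the full `ε_n` of `log_half_rankinBound_primes_le`,
i.e. the elementary part plus `log((n+1) log p_n / p_n) → 0` and
`(∑_{i<n} log p_{i+1})/(n+1) - log p_n + 1 → 0` (prime number theorem,
`tendsto_card_mul_log_nth_prime_div`, `tendsto_sum_log_nth_prime_div_sub_log`).
[cite: Bright2024, §3.1] -/
theorem tendsto_brightError {x : ℝ} (q : ℝ) (hx0 : 0 < x) :
    Tendsto (fun n : ℕ => (-Real.log (1 - 1 / ((n + 1 : ℕ) : ℝ))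
          + (Real.log q + Real.log 2 + 3 * Real.log n + Real.log ((n + 1 : ℕ) : ℝ)
              + 3 / 2 * Real.log (x * ((n + 1 : ℕ) : ℝ) + 1)) / ((n + 1 : ℕ) : ℝ)
          + x * Real.log (1 + 1 / (x * ((n + 1 : ℕ) : ℝ))))
        + Real.log (((n + 1 : ℕ) : ℝ) * Real.log (Nat.nth Nat.Prime n) / (Nat.nth Nat.Prime n))
        + ((∑ i : Fin n, Real.log (Nat.nth Nat.Prime (i + 1))) / ((n + 1 : ℕ) : ℝ)
            - Real.log (Nat.nth Nat.Prime n) + 1)) atTop (𝓝 0) := by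
  have h1 := tendsto_brightError_elem q hx0
  have h2 : Tendsto (fun n : ℕ => Real.log (((n + 1 : ℕ) : ℝ) * Real.log (Nat.nth Nat.Prime n)
      / (Nat.nth Nat.Prime n))) atTop (𝓝 0) := by
    have := (Literature.NumberTheory.LFunctions.tendsto_card_mul_log_nth_prime_div).log one_ne_zero
    simpa using this
  have h3 : Tendsto (fun n : ℕ => (∑ i : Fin n, Real.log (Nat.nth Nat.Prime (i + 1)))
      / ((n + 1 : ℕ) : ℝ) - Real.log (Nat.nth Nat.Prime n) + 1) atTop (𝓝 0) := by
    have := (Literature.NumberTheory.LFunctions.tendsto_sum_log_nth_prime_div_sub_log).add_const 1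
    simpa using this
  have := (h1.add h2).add h3
  simpa using this

/-! ### `2 log p_n + C < 3 log n` eventually -/

/-- For every constant `C`, eventually `2 log p_n + C < 3 log n` (`p_n ≤ 2(n+1) log p_n`
eventually by the prime number theorem, and `log p_n ≤ 2√p_n`). [folklore] -/
theorem eventually_two_log_nth_prime_add_lt (C : ℝ) :
    ∀ᶠ n : ℕ in atTop, 2 * Real.log (Nat.nth Nat.Prime n) + C < 3 * Real.log n := by
  have hα := Literature.NumberTheory.LFunctions.tendsto_card_mul_log_nth_prime_div
  have hαev : ∀ᶠ n : ℕ in atTop, (1 : ℝ) / 2 < ((n + 1 : ℕ) : ℝ) * Real.log (Nat.nth Nat.Prime n)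
      / (Nat.nth Nat.Prime n) := hα.eventually_const_lt (by norm_num)
  set C' : ℝ := C + 5 * Real.log 2 with hC'
  -- `(2 log(2z + log 16) + C')/z → 0`
  have hsmall : Tendsto (fun z : ℝ => (2 * Real.log (2 * z + Real.log 16) + C') / z) atTop (𝓝 0) := by
    have h1 : Tendsto (fun y : ℝ => Real.log y ^ 1 / (1 / 2 * y + -(Real.log 16 / 2))) atTop (𝓝 0) :=
      Real.tendsto_pow_log_div_mul_add_atTop (1 / 2) (-(Real.log 16 / 2)) 1 (by norm_num)
    have h2 : Tendsto (fun z : ℝ => 2 * z + Real.log 16) atTop atTop :=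
      tendsto_atTop_add_const_right _ _ (tendsto_id.const_mul_atTop two_pos)
    have h3 : Tendsto (fun z : ℝ => Real.log (2 * z + Real.log 16) / z) atTop (𝓝 0) := by
      refine (h1.comp h2).congr (fun z => ?_)
      simp only [Function.comp_apply, pow_one]
      congr 1
      ring
    have h4 : Tendsto (fun z : ℝ => C' / z) atTop (𝓝 0) := tendsto_const_nhds.div_atTop tendsto_id
    have := (h3.const_mul 2).add h4
    rw [mul_zero, zero_add] at this
    refine this.congr' ?_
    filter_upwards [eventually_ne_atTop 0] with z hz
    field_simp
  have hz : Tendsto (fun n : ℕ => Real.log ((n + 1 : ℕ) : ℝ)) atTop atTop :=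
    Real.tendsto_log_atTop.comp (tendsto_natCast_atTop_atTop.comp (tendsto_add_atTop_nat 1))
  have hev2 : ∀ᶠ n : ℕ in atTop, (2 * Real.log (2 * Real.log ((n + 1 : ℕ) : ℝ) + Real.log 16) + C')
      / Real.log ((n + 1 : ℕ) : ℝ) < 1 := (hsmall.comp hz).eventually (gt_mem_nhds zero_lt_one)
  filter_upwards [hαev, hev2, eventually_ge_atTop 2] with n hαn h2n hn
  -- notation
  set N : ℝ := ((n + 1 : ℕ) : ℝ) with hN
  set P : ℝ := ((Nat.nth Nat.Prime n : ℕ) : ℝ) with hP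
  have hNn : N = (n : ℝ) + 1 := by rw [hN]; push_cast; ring
  have hn2 : (2 : ℝ) ≤ n := by exact_mod_cast hn
  have hN1 : 1 < N := by rw [hNn]; linarith
  have hlogN : 0 < Real.log N := Real.log_pos hN1
  have hP3 : (3 : ℝ) ≤ P := by
    rw [hP]
    obtain ⟨k, rfl⟩ : ∃ k, n = k + 1 := ⟨n - 1, by omega⟩
    exact_mod_cast three_le_nth_prime_succ k
  have hP0 : 0 < P := by linarith
  have hlogP : 0 < Real.log P := Real.log_pos (by linarith)
  -- `P < 2 N log P`
  have h1 : P < 2 * N * Real.log P := by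
    rw [lt_div_iff₀ hP0] at hαn
    linarith
  -- `log P ≤ 2 √P`, hence `P < 16 N²`
  have h2 : Real.log P ≤ 2 * Real.sqrt P := by
    have := Real.log_le_rpow_div hP0.le (by norm_num : (0 : ℝ) < 1 / 2)
    rw [Real.sqrt_eq_rpow]
    linarith
  have h3 : Real.sqrt P < 4 * N := by
    have hsq : 0 < Real.sqrt P := Real.sqrt_pos.mpr hP0
    have : Real.sqrt P * Real.sqrt P < 4 * N * Real.sqrt P := by
      rw [Real.mul_self_sqrt hP0.le]; nlinarith
    exact lt_of_mul_lt_mul_right this hsq.le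
  have h4 : Real.log P < Real.log 16 + 2 * Real.log N := by
    have hP16 : P < 16 * N ^ 2 := by
      have := Real.sq_sqrt hP0.le
      nlinarith [Real.sqrt_nonneg P]
    have := Real.log_lt_log hP0 hP16
    rw [Real.log_mul (by norm_num) (by positivity), Real.log_pow] at this
    push_cast at this
    linarith
  -- `log P < log 2 + log N + log log P ≤ log 2 + log N + log(log 16 + 2 log N)`
  have h5 : Real.log P < Real.log 2 + Real.log N + Real.log (Real.log 16 + 2 * Real.log N) := by
    have := Real.log_lt_log hP0 h1
    rw [Real.log_mul (by positivity) hlogP.ne', Real.log_mul two_ne_zero (by positivity)] at this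
    have h6 : Real.log (Real.log P) ≤ Real.log (Real.log 16 + 2 * Real.log N) :=
      Real.log_le_log hlogP h4.le
    linarith
  -- conclude
  have h7 : 2 * Real.log (2 * Real.log N + Real.log 16) + C' < Real.log N := by
    rw [div_lt_one hlogN] at h2n; exact h2n
  have h8 : Real.log N - Real.log 2 ≤ Real.log n := by
    rw [← Real.log_div (by positivity) two_ne_zero]
    exact Real.log_le_log (by positivity) (by rw [hNn]; linarith)
  have h9 : Real.log (Real.log 16 + 2 * Real.log N) = Real.log (2 * Real.log N + Real.log 16) := by
    rw [add_comm]
  rw [h9] at h5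
  rw [hC'] at h7
  linarith


/-! ### One value of `n`: from the bounds to an abc triple -/

/-- **Deterministic core of Bright's Theorem 3.1 at level `n`.** Let `0 < x < 1`, `q = 1/x`,
`κ ≥ 0`, `n ≥ 4`, and suppose that for some reals `A`, `E` the Rankin bound `B`
for the first `n` odd primes (`ρ = 1 - 1/(n+1)`, `2^{m-1} = 2^{⌈(Θ+2(n+1))/log 2⌉}`) satisfies
`log(B/2) ≤ 2 log p_n + A + E`, that `κ e^{(A+E)/2} < 2(n+1)(2 log p_n + A + E)/p_n`, and that
`log 2 + 2 log p_n + A + E < 3 log n`. Then the abc triple of Lemma 3.1 satisfies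
`rad(abc) · exp(κ √(log c)/log log c) < c` and `log c > 2(n+1)` (Bright 2024, §3.1: `B < n³`,
`log(c/rad) > log 2^{m-1} - Θ ≥ 2(n+1)`, `log c ≤ B/2 ≤ e^{2 log p_n + A + E}`, and
`√s/log s` is increasing). [cite: Bright2024, §3.1 and Theorem 3.1] -/
theorem exists_abcTriple_exp_lt {x q κ A E : ℝ} (hx0 : 0 < x) (hx1 : x < 1) (hqx : x * q = 1)
    (hκ : 0 ≤ κ) {n : ℕ} (hn : 4 ≤ n)
    (hhalf : Real.log ((1 / ((1 - 1 / ((n + 1 : ℕ) : ℝ)) * (((2 * q - 1) / (q - 1)) ^ (q - 1)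
        * ((n + 1 : ℕ) : ℝ) ^ (1 - q)) ^ (1 / q))) *
      (q * ((2 : ℝ) ^ (⌈((∑ i : Fin n, Real.log (Nat.nth Nat.Prime (i + 1)))
          + 2 * ((n + 1 : ℕ) : ℝ)) / Real.log 2⌉₊)
          * ((n : ℝ) ^ 3 * ∏ i : Fin n, Real.log (Nat.nth Nat.Prime (i + 1))))
        / ((1 - (1 - 1 / ((n + 1 : ℕ) : ℝ)) ^ q) *
          ((2 * Real.Gamma (1 / q + 1)) ^ (n + 1) / Real.Gamma ((n + 1 : ℕ) / q + 1))))
        ^ (1 / ((n + 1 : ℕ) : ℝ)))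
      ≤ 2 * Real.log (Nat.nth Nat.Prime n) + A + E)
    (hfin : κ * Real.exp ((A + E) / 2)
      < 2 * ((n + 1 : ℕ) : ℝ) * (2 * Real.log (Nat.nth Nat.Prime n) + A + E) / (Nat.nth Nat.Prime n))
    (hcube : Real.log 2 + (2 * Real.log (Nat.nth Nat.Prime n) + A + E) < 3 * Real.log n) :
    ∃ a b c : ℕ, IsABCTriple a b c ∧
      (rad a b c : ℝ) * Real.exp (κ * Real.sqrt (Real.log c) / Real.log (Real.log c)) < c ∧
      2 * ((n + 1 : ℕ) : ℝ) < Real.log c := by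
  -- notation
  set N : ℝ := ((n + 1 : ℕ) : ℝ) with hN
  set P : ℝ := ((Nat.nth Nat.Prime n : ℕ) : ℝ) with hP
  set Θ : ℝ := ∑ i : Fin n, Real.log (Nat.nth Nat.Prime (i + 1)) with hΘ
  set G : ℝ := ∏ i : Fin n, Real.log (Nat.nth Nat.Prime (i + 1)) with hG
  set k : ℕ := ⌈(Θ + 2 * N) / Real.log 2⌉₊ with hk
  set ρ : ℝ := 1 - 1 / N with hρ
  set Half : ℝ := (1 / (ρ * (((2 * q - 1) / (q - 1)) ^ (q - 1) * N ^ (1 - q)) ^ (1 / q))) *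
      (q * ((2 : ℝ) ^ k * ((n : ℝ) ^ 3 * G))
        / ((1 - ρ ^ q) * ((2 * Real.Gamma (1 / q + 1)) ^ (n + 1) / Real.Gamma (N / q + 1))))
        ^ (1 / N) with hHalf
  clear_value Half k G Θ ρ P N
  have hNn : N = (n : ℝ) + 1 := by rw [hN]; push_cast; ring
  have hn4 : (4 : ℝ) ≤ n := by exact_mod_cast hn
  have hN5 : (5 : ℝ) ≤ N := by rw [hNn]; linarith
  have hN0 : 0 < N := by linarith
  have hq : q = 1 / x := by field_simp; linarith [hqx]
  have hq1 : 1 < q := by rw [hq, lt_div_iff₀ hx0]; linarith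
  have hq0 : 0 < q := by linarith
  have hρ0 : 0 < ρ := by rw [hρ, sub_pos, div_lt_one hN0]; linarith
  have hρ1 : ρ < 1 := by rw [hρ]; have := one_div_pos.mpr hN0; linarith
  have hP3 : (3 : ℝ) ≤ P := by
    rw [hP]
    obtain ⟨j, rfl⟩ : ∃ j, n = j + 1 := ⟨n - 1, by omega⟩
    exact_mod_cast three_le_nth_prime_succ j
  have hP0 : 0 < P := by linarith
  -- the primes
  have hpp : ∀ i : Fin n, (Nat.nth Nat.Prime (i + 1)).Prime := prime_nth_prime_succ n
  have hp2 : ∀ i : Fin n, Nat.nth Nat.Prime (i + 1) ≠ 2 := nth_prime_succ_ne_two n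
  have hinj : Function.Injective (fun i : Fin n => Nat.nth Nat.Prime (i + 1)) :=
    nth_prime_succ_injective n
  have hp3 : ∀ i : Fin n, (3 : ℝ) ≤ Nat.nth Nat.Prime (i + 1) := fun i => by
    exact_mod_cast three_le_nth_prime_succ (i : ℕ)
  have hlogp : ∀ i : Fin n, 0 < Real.log (Nat.nth Nat.Prime (i + 1)) := fun i =>
    Real.log_pos (by linarith [hp3 i])
  have hG0 : 0 < G := by rw [hG]; exact Finset.prod_pos fun i _ => hlogp i
  -- positivity of `Half`
  have hρq : 0 < 1 - ρ ^ q := by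
    have := Real.rpow_lt_one hρ0.le hρ1 hq0; linarith
  have hV0 : 0 < (2 * Real.Gamma (1 / q + 1)) ^ (n + 1) / Real.Gamma (N / q + 1) := by
    have := Real.Gamma_pos_of_pos (show 0 < 1 / q + 1 by positivity)
    have := Real.Gamma_pos_of_pos (show 0 < N / q + 1 by positivity)
    positivity
  have hBase0 : 0 < q * ((2 : ℝ) ^ k * ((n : ℝ) ^ 3 * G))
      / ((1 - ρ ^ q) * ((2 * Real.Gamma (1 / q + 1)) ^ (n + 1) / Real.Gamma (N / q + 1))) := by
    positivity
  have hR0 : 0 < ρ * (((2 * q - 1) / (q - 1)) ^ (q - 1) * N ^ (1 - q)) ^ (1 / q) := by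
    refine mul_pos hρ0 (Real.rpow_pos_of_pos (mul_pos ?_ (Real.rpow_pos_of_pos hN0 _)) _)
    exact Real.rpow_pos_of_pos (div_pos (by linarith) (by linarith)) _
  have hHalf0 : 0 < Half := by
    rw [hHalf]
    exact mul_pos (by positivity) (Real.rpow_pos_of_pos hBase0 _)
  -- `B = 2 Half`, `Half ≤ e^Λ`, `B < n³`
  have hBeq : 2 / (ρ * (((2 * q - 1) / (q - 1)) ^ (q - 1) * N ^ (1 - q)) ^ (1 / q)) *
      (q * ((2 : ℝ) ^ (k + 1 - 1) * ((n : ℝ) ^ 3 * ∏ i : Fin n, Real.log (Nat.nth Nat.Prime (i + 1))))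
        / ((1 - ρ ^ q) * ((2 * Real.Gamma (1 / q + 1)) ^ (n + 1) / Real.Gamma (N / q + 1))))
        ^ (1 / N) = 2 * Half := by
    rw [Nat.add_sub_cancel, hHalf, hG]
    ring
  have hHalfle : Half ≤ Real.exp (2 * Real.log P + A + E) := by
    rw [← Real.log_le_iff_le_exp hHalf0]; exact hhalf
  have h2Half : 2 * Half < (n : ℝ) ^ 3 := by
    have hlog : Real.log (2 * Half) < Real.log ((n : ℝ) ^ 3) := by
      rw [Real.log_mul two_ne_zero hHalf0.ne', Real.log_pow]
      push_cast
      linarith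
    exact (Real.log_lt_log_iff (by positivity) (by positivity)).mp hlog
  have hB : 2 / (ρ * (((2 * q - 1) / (q - 1)) ^ (q - 1) * N ^ (1 - q)) ^ (1 / q)) *
      (q * ((2 : ℝ) ^ (k + 1 - 1) * ((n : ℝ) ^ 3 * ∏ i : Fin n, Real.log (Nat.nth Nat.Prime (i + 1))))
        / ((1 - ρ ^ q) * ((2 * Real.Gamma (1 / q + 1)) ^ (n + 1) / Real.Gamma (N / q + 1))))
        ^ (1 / N) < (n : ℝ) ^ 3 := by
    rw [hBeq]; exact h2Half
  -- Lemma 3.1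
  rw [hN] at hB
  obtain ⟨a, b, c, habc, hrad, hle⟩ := exists_abcTriple_two_mul_log_le_rankinBound
    (by omega) (fun i : Fin n => Nat.nth Nat.Prime (i + 1)) hpp hp2 hinj (m := k + 1) (by omega)
    hq1 hρ0 hρ1 hB
  rw [← hN] at hle
  rw [hBeq] at hle
  clear hB hBeq hHalf hBase0 hV0 hR0 hhalf
  rw [Nat.add_sub_cancel] at hrad
  have hc0 : (0 : ℝ) < c := by
    have := habc.2.2.1; have := habc.1
    exact_mod_cast (show 0 < c by omega)
  have hrad0 : (0 : ℝ) < rad a b c := by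
    exact_mod_cast Nat.pos_of_ne_zero (UniqueFactorizationMonoid.radical_ne_zero)
  have hrad1 : (1 : ℝ) ≤ rad a b c := by
    exact_mod_cast Nat.pos_of_ne_zero (UniqueFactorizationMonoid.radical_ne_zero)
  -- `log(c/rad) > log 2^k - Θ ≥ 2N`
  have hE : 2 * N < Real.log c - Real.log (rad a b c) := by
    have hprod0 : (0 : ℝ) < ∏ i : Fin n, ((Nat.nth Nat.Prime (i + 1) : ℕ) : ℝ) :=
      Finset.prod_pos fun i _ => by linarith [hp3 i]
    have hradR : (2 : ℝ) ^ k * (rad a b c : ℝ)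
        < (c : ℝ) * ∏ i : Fin n, ((Nat.nth Nat.Prime (i + 1) : ℕ) : ℝ) := by
      exact_mod_cast hrad
    have hlog := Real.log_lt_log (by positivity) hradR
    rw [Real.log_mul (by positivity) hrad0.ne', Real.log_mul hc0.ne' hprod0.ne',
      Real.log_prod (s := Finset.univ) (fun i _ => by linarith [hp3 i]), Real.log_pow, ← hΘ] at hlog
    have hkΘ : Θ + 2 * N ≤ (k : ℝ) * Real.log 2 := by
      have hl2 : 0 < Real.log 2 := Real.log_pos one_lt_two
      have := Nat.le_ceil ((Θ + 2 * N) / Real.log 2)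
      rw [← hk, div_le_iff₀ hl2] at this
      exact this
    linarith
  -- `s = log c`
  set s : ℝ := Real.log c with hs
  have hlograd : 0 ≤ Real.log (rad a b c) := Real.log_nonneg hrad1
  have hs2N : 2 * N < s := by linarith
  have hexp2 : Real.exp 2 < 10 := by
    have h := Real.exp_one_lt_d9
    have : Real.exp 2 = Real.exp 1 * Real.exp 1 := by rw [← Real.exp_add]; norm_num
    rw [this]; nlinarith [Real.exp_pos 1]
  have hs0 : 0 < s := by linarith
  have hlogs : 2 ≤ Real.log s := by
    rw [Real.le_log_iff_exp_le hs0]; linarith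
  -- `s ≤ Half ≤ e^Λ`
  set Λ : ℝ := 2 * Real.log P + A + E with hΛ
  clear_value Λ
  have hsHalf : s ≤ Half := by linarith
  have hsU : s ≤ Real.exp Λ := hsHalf.trans hHalfle
  have hΛs : Real.log s ≤ Λ := by
    have := Real.log_le_log hs0 hsU
    rwa [Real.log_exp] at this
  have hΛ2 : 2 ≤ Λ := hlogs.trans hΛs
  have hΛ0 : 0 < Λ := by linarith
  -- monotonicity of `√s/log s`
  have hmono : Real.sqrt s / Real.log s ≤ Real.exp (Λ / 2) / Λ := by
    have := sqrt_div_log_le_sqrt_div_log hs0 hlogs hsU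
    have hsq : Real.sqrt (Real.exp Λ) = Real.exp (Λ / 2) := by
      have : Real.exp Λ = Real.exp (Λ / 2) ^ 2 := by
        rw [← Real.exp_nat_mul]; ring_nf
      rw [this, Real.sqrt_sq (Real.exp_pos _).le]
    rwa [hsq, Real.log_exp] at this
  -- the final inequality at level `n`
  have hexpΛ : Real.exp (Λ / 2) = P * Real.exp ((A + E) / 2) := by
    rw [hΛ, show (2 * Real.log P + A + E) / 2 = Real.log P + (A + E) / 2 by ring, Real.exp_add,
      Real.exp_log hP0]
  have hfin' : κ * Real.exp (Λ / 2) / Λ < 2 * N := by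
    rw [div_lt_iff₀ hΛ0, hexpΛ]
    rw [lt_div_iff₀ hP0] at hfin
    calc κ * (P * Real.exp ((A + E) / 2)) = κ * Real.exp ((A + E) / 2) * P := by ring
      _ < 2 * N * Λ := hfin
  have hkey : κ * Real.sqrt s / Real.log s < s - Real.log (rad a b c) := by
    calc κ * Real.sqrt s / Real.log s = κ * (Real.sqrt s / Real.log s) := by ring
      _ ≤ κ * (Real.exp (Λ / 2) / Λ) := mul_le_mul_of_nonneg_left hmono hκ
      _ = κ * Real.exp (Λ / 2) / Λ := by ring
      _ < 2 * N := hfin'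
      _ < s - Real.log (rad a b c) := hE
  refine ⟨a, b, c, habc, ?_, hs2N⟩
  have h1 : Real.log (rad a b c) + κ * Real.sqrt s / Real.log s < s := by linarith
  have h2 := Real.exp_lt_exp.mpr h1
  rw [Real.exp_add, Real.exp_log hrad0, hs, Real.exp_log hc0] at h2
  exact h2


/-! ### Bright's Theorem 3.1 -/

/-- **Bright 2024, Theorem 3.1 (with the Rankin constant at a parameter `x`).** Let `0 < x < 1`
and `κ ≥ 0` with `κ² e/32 < δ(x) = ((1-x)/(2-x))^{x-1} (e/x)^x Γ(1+x)`, i.e. `κ < 4√(2δ(x)/e)`.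
Then there are infinitely many abc triples `(a, b, c)` with
`rad(abc) · exp(κ √(log c) / log log c) < c`. (The paper takes the optimal `x ≈ 0.6455`,
`δ ≈ 3.65931`, `4√(2δ/e) ≈ 6.56338`.) Proof: for all large `n` the core step
`exists_abcTriple_exp_lt` applies to the first `n` odd primes (`log_half_rankinBound_primes_le`,
`tendsto_brightError`, `eventually_two_log_nth_prime_add_lt`, and
`κ e^{(log(e/2δ)+ε_n)/2} → κ √(e/(2δ)) < 4 ← 2(n+1)(2 log p_n + log(e/2δ) + ε_n)/p_n`), and the
triples obtained have `log c > 2(n+1) → ∞`. [cite: Bright2024, Theorem 3.1] -/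
theorem bright_infinite_abcTriples {x κ : ℝ} (hx0 : 0 < x) (hx1 : x < 1) (hκ0 : 0 ≤ κ)
    (hκ : κ ^ 2 * Real.exp 1 / 32
      < ((1 - x) / (2 - x)) ^ (x - 1) * (Real.exp 1 / x) ^ x * Real.Gamma (x + 1)) :
    {t : ℕ × ℕ × ℕ | IsABCTriple t.1 t.2.1 t.2.2 ∧
      (rad t.1 t.2.1 t.2.2 : ℝ) * Real.exp (κ * Real.sqrt (Real.log t.2.2)
        / Real.log (Real.log t.2.2)) < t.2.2}.Infinite := by
  set δ : ℝ := ((1 - x) / (2 - x)) ^ (x - 1) * (Real.exp 1 / x) ^ x * Real.Gamma (x + 1) with hδ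
  have hδ0 : 0 < δ := by
    have hrat : 0 < (1 - x) / (2 - x) := div_pos (by linarith) (by linarith)
    have := Real.Gamma_pos_of_pos (show 0 < x + 1 by linarith)
    rw [hδ]; positivity
  set q : ℝ := 1 / x with hq
  have hqx : x * q = 1 := by rw [hq]; field_simp
  set K₀ : ℝ := Real.log (Real.exp 1 / (2 * δ)) with hK₀
  -- the error term and its limit
  set ε : ℕ → ℝ := fun n => (-Real.log (1 - 1 / ((n + 1 : ℕ) : ℝ))
          + (Real.log q + Real.log 2 + 3 * Real.log n + Real.log ((n + 1 : ℕ) : ℝ)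
              + 3 / 2 * Real.log (x * ((n + 1 : ℕ) : ℝ) + 1)) / ((n + 1 : ℕ) : ℝ)
          + x * Real.log (1 + 1 / (x * ((n + 1 : ℕ) : ℝ))))
        + Real.log (((n + 1 : ℕ) : ℝ) * Real.log (Nat.nth Nat.Prime n) / (Nat.nth Nat.Prime n))
        + ((∑ i : Fin n, Real.log (Nat.nth Nat.Prime (i + 1))) / ((n + 1 : ℕ) : ℝ)
            - Real.log (Nat.nth Nat.Prime n) + 1) with hε
  have hεt : Tendsto ε atTop (𝓝 0) := tendsto_brightError q hx0
  -- the prime number theorem inputs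
  have hα := Literature.NumberTheory.LFunctions.tendsto_card_mul_log_nth_prime_div
  have hPtop := Literature.NumberTheory.LFunctions.tendsto_nth_prime_atTop
  have hlogP : Tendsto (fun n : ℕ => Real.log (Nat.nth Nat.Prime n)) atTop atTop :=
    Real.tendsto_log_atTop.comp hPtop
  -- left-hand side: `κ exp((K₀ + ε_n)/2) → κ exp(K₀/2) < 4`
  have hL : Tendsto (fun n : ℕ => κ * Real.exp ((K₀ + ε n) / 2)) atTop
      (𝓝 (κ * Real.exp (K₀ / 2))) := by
    have h1 : Tendsto (fun n : ℕ => (K₀ + ε n) / 2) atTop (𝓝 (K₀ / 2)) := by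
      have := (hεt.const_add K₀).div_const 2
      simpa using this
    exact ((Real.continuous_exp.tendsto _).comp h1).const_mul κ
  have hlim : κ * Real.exp (K₀ / 2) < 4 := by
    have hsq : (κ * Real.exp (K₀ / 2)) ^ 2 = κ ^ 2 * (Real.exp 1 / (2 * δ)) := by
      rw [mul_pow, ← Real.exp_nat_mul, show ((2 : ℕ) : ℝ) * (K₀ / 2) = K₀ by push_cast; ring, hK₀,
        Real.exp_log (by positivity)]
    have h16 : κ ^ 2 * (Real.exp 1 / (2 * δ)) < 4 ^ 2 := by
      rw [show κ ^ 2 * (Real.exp 1 / (2 * δ)) = (κ ^ 2 * Real.exp 1 / 32) * (16 / δ) by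
        field_simp; ring]
      calc κ ^ 2 * Real.exp 1 / 32 * (16 / δ) < δ * (16 / δ) :=
            mul_lt_mul_of_pos_right hκ (by positivity)
        _ = 4 ^ 2 := by field_simp; norm_num
    rw [← hsq] at h16
    exact lt_of_pow_lt_pow_left₀ 2 (by norm_num) h16
  -- right-hand side: `2N(2 log P + K₀ + ε_n)/P → 4`
  have hR : Tendsto (fun n : ℕ => 2 * ((n + 1 : ℕ) : ℝ) * (2 * Real.log (Nat.nth Nat.Prime n)
      + K₀ + ε n) / (Nat.nth Nat.Prime n)) atTop (𝓝 4) := by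
    have h1 : Tendsto (fun n : ℕ => 2 * (K₀ + ε n) / Real.log (Nat.nth Nat.Prime n)) atTop (𝓝 0) := by
      have hnum : Tendsto (fun n : ℕ => 2 * (K₀ + ε n)) atTop (𝓝 (2 * (K₀ + 0))) :=
        (hεt.const_add K₀).const_mul 2
      exact hnum.div_atTop hlogP
    have h2 : Tendsto (fun n : ℕ => ((n + 1 : ℕ) : ℝ) * Real.log (Nat.nth Nat.Prime n)
        / (Nat.nth Nat.Prime n) * (4 + 2 * (K₀ + ε n) / Real.log (Nat.nth Nat.Prime n)))
        atTop (𝓝 (1 * (4 + 0))) := hα.mul (h1.const_add 4)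
    rw [one_mul, add_zero] at h2
    refine h2.congr' ?_
    filter_upwards [hPtop.eventually_ge_atTop 3] with n hn3
    have hP0 : (0 : ℝ) < Nat.nth Nat.Prime n := by linarith
    have hlog : 0 < Real.log (Nat.nth Nat.Prime n) := Real.log_pos (by linarith)
    field_simp
    ring
  have hev1 : ∀ᶠ n : ℕ in atTop, κ * Real.exp ((K₀ + ε n) / 2)
      < 2 * ((n + 1 : ℕ) : ℝ) * (2 * Real.log (Nat.nth Nat.Prime n) + K₀ + ε n)
        / (Nat.nth Nat.Prime n) := hL.eventually_lt hR hlim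
  -- `log 2 + (2 log P + K₀ + ε_n) < 3 log n` eventually
  have hev2 : ∀ᶠ n : ℕ in atTop, Real.log 2 + (2 * Real.log (Nat.nth Nat.Prime n) + K₀ + ε n)
      < 3 * Real.log n := by
    have hε1 : ∀ᶠ n : ℕ in atTop, ε n < 1 := hεt.eventually (gt_mem_nhds one_pos)
    filter_upwards [hε1, eventually_two_log_nth_prime_add_lt (Real.log 2 + K₀ + 1)] with n h1 h2
    linarith
  -- `x(n+1) ≥ e` eventually
  have hev3 : ∀ᶠ n : ℕ in atTop, Real.exp 1 ≤ x * ((n + 1 : ℕ) : ℝ) := by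
    have : Tendsto (fun n : ℕ => x * ((n + 1 : ℕ) : ℝ)) atTop atTop :=
      (tendsto_natCast_atTop_atTop.comp (tendsto_add_atTop_nat 1)).const_mul_atTop hx0
    exact this.eventually_ge_atTop _
  -- the set is unbounded in `c`
  by_contra hfin
  rw [Set.not_infinite] at hfin
  obtain ⟨B, hB⟩ := (hfin.image (fun t : ℕ × ℕ × ℕ => t.2.2)).bddAbove
  obtain ⟨n, hn1, hn2, hn3, hn4, hnB⟩ :=
    (hev1.and (hev2.and (hev3.and ((eventually_ge_atTop 4).and (eventually_ge_atTop B))))).exists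
  have hhalf := log_half_rankinBound_primes_le hx0 hx1 hqx (by omega) hn3
  obtain ⟨a, b, c, habc, hlt, hlogc⟩ :=
    exists_abcTriple_exp_lt (A := K₀) (E := ε n) hx0 hx1 hqx hκ0 hn4 hhalf hn1 hn2
  have hmem : ((a, b, c) : ℕ × ℕ × ℕ) ∈ {t : ℕ × ℕ × ℕ | IsABCTriple t.1 t.2.1 t.2.2 ∧
      (rad t.1 t.2.1 t.2.2 : ℝ) * Real.exp (κ * Real.sqrt (Real.log t.2.2)
        / Real.log (Real.log t.2.2)) < t.2.2} := ⟨habc, hlt⟩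
  have hcB : c ≤ B := hB ⟨(a, b, c), hmem, rfl⟩
  -- but `c > log c > 2(n+1) > n ≥ B`
  have hc0 : (0 : ℝ) < c := by
    have := habc.2.2.1; have := habc.1
    exact_mod_cast (show 0 < c by omega)
  have h1 : Real.log c ≤ (c : ℝ) - 1 := Real.log_le_sub_one_of_pos hc0
  have h2 : ((n + 1 : ℕ) : ℝ) = (n : ℝ) + 1 := by push_cast; ring
  have h3 : (B : ℝ) ≤ n := by exact_mod_cast hnB
  have h4 : (c : ℝ) ≤ B := by exact_mod_cast hcB
  rw [h2] at hlogc
  linarith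

end Literature.NumberTheory.DiophantineGeometry

end
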